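import Summits.BirchSwinnertonDyer.BirchSwinnertonDyer.Theorems.SchneiderFreeAdditiveX3LocalTowerTorsionLine
import Summits.BirchSwinnertonDyer.BirchSwinnertonDyer.Theorems.UniversalToricDescentLocalKummerKernel
import HarnessLib

/-!
# Route `EisensteinPrimes`, crux 2 `GoodLatticeBDPValue` (stmt-BirchSwinnertonDyer-19032), line `halves`, V20 road
# brick (f), part 1: `p`-POWER DESCENT from a closed `D ≤ Γ_K` to its local tower group `D ⊓ Gal(K̄/K_∞)` —
# for a line of order `p`, for a finite stable `T ⊇ Φ` with `#T = p²`, and cocyclicity of `p`-primary subgroups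

Cell `bsd-eis` (home `run/shared/lean/pub/bsd-eis/`), width seat `bsd-line-x1-p1-w2` gen 3 (`--supports -19032`,
closes nothing). The V20 road for `stub_imprimLambda` (LEAD g3 memo `Cruxes/GoodLatticeBDPValue/Lines/halves-imprimLambda-road.md`)
runs Keller–Yin's residual dévissage of Thm. 1.4.1 in the `K_∞`-currency; its E-side local inputs at the ANOMALOUS place
`v̄ ∣ p` (KY arXiv:2402.12781v2 §1.3: Prop. 1.3.3 (ii)–(iii) «`H⁰(K_w, V_f/T_f)` and `H⁰(K_w, M_f)` are (finite) cyclic»,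
Lemma 1.3.5 «`ker(res_{M_f[𝔭]}) ∈ {0, 𝔽}`», and Cases I–III «`H⁰(K_{v̄}, M_f) ≠ 0` or `= 0`») are statements about
the fixed points of the LOCAL TOWER GROUP `D_v̄ ⊓ Gal(K̄/K_∞)` on the ramified line `𝔽(ω̃)`, on `E[p]` and on `E[p^∞]`.
The tree's residual counts (x2-p2's `…ResidualDevissage*`, UTD's `…ResidualSelmerExact`) carry instead the hypothesis
(L) «`E(K_{∞,v̄})[p] = 0`», which FAILS in KY's Cases I–II (`E(ℚ_p)[p] ≠ 0` happens at an anomalous prime). This file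
and its sequel `…AnomalousLocalTorsion` prove what replaces (L), for ANY `ℤ_p`-extension `κ` of a number field `K`, ANY
closed `D ≤ Γ_K` (e.g. `D = D_v̄ = GreenbergSelmer.decomp v̄`) and its local tower group `N = D ⊓ ker κ`; the only input
is ONE element `τ ∈ D` moving the line (at the good anomalous datum: an inertia element acting non-trivially on `𝔽(ω̃)`).

* §1 **`p`-POWER DESCENT ON A LINE.** For a finite line `Φ` (`#Φ = p`) in a discrete `Γ_K`-module with continuous
  orbit maps: if `τ ∈ D` maps `Φ` into itself and `N` fixes `Φ` pointwise, then `τ` fixes `Φ` pointwise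
  (`smul_eq_of_fixed_inf_kerSubgroup`: the open pointwise stabiliser of `Φ` contains `N`, hence a layer
  `D ⊓ κ⁻¹(pⁿℤ_p)` (tree `exists_layerSubgroup_inf_subset`), hence `τ^{pⁿ}`; on `Φ ≅ ℤ/p` the element `τ` acts by
  `a ∈ ℤ` with `a^{pⁿ} ≡ a (mod p)`). Contrapositive **`exists_mem_inf_kerSubgroup_smul_ne`**: a mover of `Φ` in `D`
  yields a mover in `N`; so `Φ^N = 0` (`eq_zero_of_mem_line_of_fixed`). At `v̄` for the good lattice: the ramified
  line `𝔽(ω̃)` has NO non-zero `K_{∞,v̄}`-rational point (KY: `H⁰(K_{∞,w}, F/𝒪(φ)) = 0`, TeX L944–946; «`I_w/I_{w,∞}`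
  is pro-`p` while the trivializing extension of `ω` has order dividing `p − 1`», L1043).
* §2 **THE FIXED PART OF A FINITE STABLE `T ⊇ Φ`** (`T = E[p]`): `#T^N · p ≤ #T` (`natCard_mul_le_of_fixed`), and for
  `#T = p²`: **`T^N = T^D`** (`smul_eq_of_fixed_of_natCard_eq_sq` — KY's Case I/II-vs-III indicator
  `E(K_{∞,v̄})[p] = E(K_v̄)[p]`).
* §3 **COCYCLICITY.** In a `p`-primary group with finite layers, a subgroup `B` with `#B[p] ≤ p` is finite or
  `p`-divisible (`finite_or_forall_exists_nsmul_eq`), so `#(B/pB) ≤ p` either way (`natCard_quotient_nsmul_le`) —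
  KY Prop. 1.3.3 (ii)–(iii)'s «cyclic: `𝒪/𝔭^b` or `F/𝒪`» for `B = E[p^∞]^N`.

HONEST FRAMING: helper theorems only (0 definitions, 0 named facts, 0 sorry); the mover `τ` is a HYPOTHESIS; no summit
statement, no BSD / IMC2 / KY Thm 1.4.1 (iii) is proved; 0 cells / labels move.
References: [KellerYin2024] §1.3 Prop. 1.3.3, Lemmas 1.3.4–1.3.6, §1.4 Cases I–III (arXiv:2402.12781v2 TeX L922–1060,
L1140–1160); [GreenbergLNM1716] §3 Lemma 3.3 and proof of Prop. 4.8 p. 109 (the `p`-group fixed-point principle);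
[Washington1997] §13.1.
-/

set_option autoImplicit false
-- the route's Theorems namespace repeats the summit name by design (D-0017 nested layout)
set_option linter.dupNamespace false

noncomputable section

open scoped Classical

namespace Summit.BirchSwinnertonDyer.BirchSwinnertonDyer.Theorems.AnomalousLocalTorsion

open NumberField IsDedekindDomain Field WeierstrassCurve
  Literature.NumberTheory.EllipticCurves Literature.NumberTheory.EllipticCurves.GreenbergSelmer
  Literature.NumberTheory.GaloisRepresentations
  Summit.BirchSwinnertonDyer.Rank1Residual.X11b
  Summit.BirchSwinnertonDyer.BirchSwinnertonDyer.Theorems.SchneiderFreeAdditiveX3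

variable {K : Type} [Field K] [NumberField K] {p : ℕ} [hp : Fact p.Prime] (κ : ZpExtension K p)

/-! ## §1. `p`-power descent on a line of order `p` -/

section Line

variable {M : Type} [AddCommGroup M] [DistribMulAction (absoluteGaloisGroup K) M]
  [TopologicalSpace M] [DiscreteTopology M]

omit [NumberField K] [DistribMulAction (absoluteGaloisGroup K) M] [TopologicalSpace M]
  [DiscreteTopology M] in
/-- A non-zero element of a subgroup of prime order `p` generates it: every element is an integer
multiple, and `p` kills the generator. [folklore] -/
theorem exists_zsmul_eq_of_natCard_eq (Φ : AddSubgroup M) (hΦ : Nat.card Φ = p) {P₀ : M} (h₀ : P₀ ∈ Φ)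
    (hne : P₀ ≠ 0) : (p • P₀ = 0) ∧ ∀ P ∈ Φ, ∃ k : ℤ, k • P₀ = P := by
  have hpr : p.Prime := hp.out
  haveI : Finite Φ := Nat.finite_of_card_ne_zero (by rw [hΦ]; exact hpr.ne_zero)
  have hdvd : addOrderOf P₀ ∣ p := by
    rw [← hΦ]; exact AddSubgroup.addOrderOf_dvd_natCard Φ h₀
  have hord : addOrderOf P₀ = p := by
    rcases (Nat.dvd_prime hpr).mp hdvd with h1 | h1
    · exact absurd (AddMonoid.addOrderOf_eq_one_iff.mp h1) hne
    · exact h1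
  have hle : AddSubgroup.zmultiples P₀ ≤ Φ := (AddSubgroup.zmultiples_le).mpr h₀
  have hcard : Nat.card (AddSubgroup.zmultiples P₀) = p := by rw [Nat.card_zmultiples, hord]
  have heq : AddSubgroup.zmultiples P₀ = Φ :=
    AddSubgroup.eq_of_le_of_card_ge hle (by rw [hΦ, hcard])
  refine ⟨?_, fun P hP ↦ ?_⟩
  · rw [← hord]; exact addOrderOf_nsmul_eq_zero P₀
  · rw [← heq, AddSubgroup.mem_zmultiples_iff] at hP
    exact hP

omit [NumberField K] [DistribMulAction (absoluteGaloisGroup K) M] [TopologicalSpace M]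
  [DiscreteTopology M] in
/-- A subgroup of prime order has a non-zero element. [folklore] -/
theorem exists_ne_zero_mem_of_natCard_eq (Φ : AddSubgroup M) (hΦ : Nat.card Φ = p) : ∃ P₀ ∈ Φ, P₀ ≠ 0 := by
  by_contra h
  push Not at h
  have hbot : Φ = ⊥ := (AddSubgroup.eq_bot_iff_forall _).mpr h
  have h1 : Nat.card Φ = 1 := by rw [hbot]; exact AddSubgroup.card_bot
  exact hp.out.one_lt.ne' (hΦ.symm.trans h1)

omit [NumberField K] [TopologicalSpace M] [DiscreteTopology M] in
/-- **Fermat on a line.** If `τ` maps the line `Φ` (`#Φ = p`) into itself and `τ^{pⁿ}` fixes `Φ` pointwise,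
then `τ` fixes `Φ` pointwise: `τ` acts on `Φ ≅ ℤ/p` by some `a ∈ ℤ`, and `a^{pⁿ} ≡ a (mod p)`. [folklore] -/
theorem smul_eq_of_pow_prime_pow_smul_eq (Φ : AddSubgroup M) (hΦ : Nat.card Φ = p)
    {τ : absoluteGaloisGroup K} (hτΦ : ∀ P ∈ Φ, τ • P ∈ Φ) {n : ℕ}
    (hfix : ∀ P ∈ Φ, τ ^ p ^ n • P = P) : ∀ P ∈ Φ, τ • P = P := by
  obtain ⟨P₀, h₀, hne⟩ := exists_ne_zero_mem_of_natCard_eq Φ hΦ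
  obtain ⟨hp₀, hgen⟩ := exists_zsmul_eq_of_natCard_eq Φ hΦ h₀ hne
  obtain ⟨a, ha⟩ := hgen _ (hτΦ P₀ h₀)
  -- `τ^k • P₀ = a^k • P₀`
  have hpow : ∀ k : ℕ, τ ^ k • P₀ = (a ^ k) • P₀ := by
    intro k
    induction k with
    | zero => rw [pow_zero, pow_zero, one_smul, one_zsmul]
    | succ k ih => rw [pow_succ', mul_smul, ih, smul_comm τ (a ^ k) P₀, ← ha, smul_smul, ← pow_succ]
  -- `a^{p^n} ≡ a (mod p)`, so `a^{p^n} • P₀ = a • P₀`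
  have hferm : ∀ m : ℕ, ((a : ZMod p)) ^ p ^ m = (a : ZMod p) := by
    intro m
    induction m with
    | zero => rw [pow_zero, pow_one]
    | succ m ih => rw [pow_succ, pow_mul, ih, ZMod.pow_card]
  have hmod : (p : ℤ) ∣ a ^ p ^ n - a := by
    rw [← ZMod.intCast_zmod_eq_zero_iff_dvd, Int.cast_sub, Int.cast_pow, sub_eq_zero]
    exact hferm n
  obtain ⟨c, hc⟩ := hmod
  have hP₀ : τ • P₀ = P₀ := by
    have h1 : (a ^ p ^ n) • P₀ = a • P₀ := by
      rw [← sub_eq_zero, ← sub_smul, hc, mul_comm, ← smul_smul, natCast_zsmul, hp₀, smul_zero]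
    rw [← ha, ← h1, ← hpow, hfix P₀ h₀]
  intro P hP
  obtain ⟨k, rfl⟩ := hgen P hP
  rw [smul_comm τ k P₀, hP₀]

/-- **`p`-power descent on a line** (the `p`-group fixed-point principle of Greenberg LNM 1716 p. 109, localised
to a closed `D ≤ Γ_K`): `M` a discrete `Γ_K`-module with continuous orbit maps, `Φ ≤ M` a line (`#Φ = p`),
`τ ∈ D` with `τ Φ ⊆ Φ`. If the local tower group `D ⊓ ker κ` fixes `Φ` pointwise, so does `τ`. Proof: the pointwise
stabiliser of the finite set `Φ` is open and contains `D ⊓ ker κ`, hence contains a layer `D ⊓ κ⁻¹(pⁿ ℤ_p)`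
(`exists_layerSubgroup_inf_subset`), hence `τ^{pⁿ}`; conclude by `smul_eq_of_pow_prime_pow_smul_eq`.
[cite: GreenbergLNM1716, §4 proof of Prop. 4.8 (p. 109)] [cite: Washington1997, §13.1] -/
theorem smul_eq_of_fixed_inf_kerSubgroup (D : Subgroup (absoluteGaloisGroup K))
    (hD : IsClosed (D : Set (absoluteGaloisGroup K)))
    (hcont : ∀ m : M, Continuous fun g : absoluteGaloisGroup K ↦ g • m)
    (Φ : AddSubgroup M) (hΦ : Nat.card Φ = p) {τ : absoluteGaloisGroup K} (hτD : τ ∈ D)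
    (hτΦ : ∀ P ∈ Φ, τ • P ∈ Φ) (hfix : ∀ g ∈ D ⊓ κ.kerSubgroup, ∀ P ∈ Φ, g • P = P) :
    ∀ P ∈ Φ, τ • P = P := by
  haveI : Finite Φ := Nat.finite_of_card_ne_zero (by rw [hΦ]; exact hp.out.ne_zero)
  have hΦfin : (Φ : Set M).Finite := Set.toFinite _
  -- the open pointwise stabiliser of `Φ`
  set V : Set (absoluteGaloisGroup K) := ⋂ P ∈ (Φ : Set M), (fun g : absoluteGaloisGroup K ↦ g • P) ⁻¹' {P}
    with hVdef
  have hV : IsOpen V := hΦfin.isOpen_biInter fun P _ ↦ (isOpen_discrete _).preimage (hcont P)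
  have hmemV : ∀ g, g ∈ V ↔ ∀ P ∈ Φ, g • P = P := by
    intro g
    simp only [hVdef, Set.mem_iInter, Set.mem_preimage, Set.mem_singleton_iff, SetLike.mem_coe]
  have hN : ∀ g ∈ D ⊓ κ.kerSubgroup, g ∈ V := fun g hg ↦ (hmemV g).mpr (hfix g hg)
  obtain ⟨n, hn⟩ := exists_layerSubgroup_inf_subset κ D hD hV hN
  have hτn : τ ^ p ^ n ∈ D ⊓ κ.layerSubgroup n :=
    Subgroup.mem_inf.mpr ⟨D.pow_mem hτD _, AcSelmer.pow_prime_pow_mem_layerSubgroup κ τ n⟩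
  exact smul_eq_of_pow_prime_pow_smul_eq Φ hΦ hτΦ ((hmemV _).mp (hn _ hτn))

/-- **A mover in `D` gives a mover in the local tower group `D ⊓ ker κ`** (contrapositive of
`smul_eq_of_fixed_inf_kerSubgroup`). At the good anomalous datum: an inertia element at `v̄` acting non-trivially on
the ramified line `𝔽(ω̃)` yields an element of `Gal(K̄_v̄/K_{∞,v̄})` doing so (KY: «`I_w/I_{w,∞}` is pro-`p` while the
trivializing extension of `ω` has order dividing `p − 1`», TeX L1043). [cite: KellerYin2024, §1.3 proof of Lemma 1.3.5 (arXiv:2402.12781v2 TeX L1040–1044)]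
[cite: GreenbergLNM1716, §4 proof of Prop. 4.8 (p. 109)] -/
theorem exists_mem_inf_kerSubgroup_smul_ne (D : Subgroup (absoluteGaloisGroup K))
    (hD : IsClosed (D : Set (absoluteGaloisGroup K)))
    (hcont : ∀ m : M, Continuous fun g : absoluteGaloisGroup K ↦ g • m)
    (Φ : AddSubgroup M) (hΦ : Nat.card Φ = p) {τ : absoluteGaloisGroup K} (hτD : τ ∈ D)
    (hτΦ : ∀ P ∈ Φ, τ • P ∈ Φ) (hmove : ∃ P ∈ Φ, τ • P ≠ P) :
    ∃ g ∈ D ⊓ κ.kerSubgroup, ∃ P ∈ Φ, g • P ≠ P := by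
  by_contra h
  push Not at h
  obtain ⟨P, hP, hne⟩ := hmove
  exact hne (smul_eq_of_fixed_inf_kerSubgroup κ D hD hcont Φ hΦ hτD hτΦ h P hP)

/-- **`Φ^{D ⊓ ker κ} = 0` for a line moved by `D`**: if some `τ ∈ D` with `τ Φ ⊆ Φ` moves a point of the line `Φ`,
then the only point of `Φ` fixed by `D ⊓ ker κ` is `0` (a non-zero fixed point generates `Φ`). At the good anomalous
datum: `𝔽(ω̃)` has no non-zero `K_{∞,v̄}`-rational point. [cite: KellerYin2024, §1.3 proof of Prop. 1.3.3 (iii) (arXiv:2402.12781v2 TeX L944–946)] -/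
theorem eq_zero_of_mem_line_of_fixed (D : Subgroup (absoluteGaloisGroup K))
    (hD : IsClosed (D : Set (absoluteGaloisGroup K)))
    (hcont : ∀ m : M, Continuous fun g : absoluteGaloisGroup K ↦ g • m)
    (Φ : AddSubgroup M) (hΦ : Nat.card Φ = p) {τ : absoluteGaloisGroup K} (hτD : τ ∈ D)
    (hτΦ : ∀ P ∈ Φ, τ • P ∈ Φ) (hmove : ∃ P ∈ Φ, τ • P ≠ P)
    {P : M} (hP : P ∈ Φ) (hfix : ∀ g ∈ D ⊓ κ.kerSubgroup, g • P = P) : P = 0 := by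
  by_contra hne
  obtain ⟨g, hg, P₁, hP₁, hgP₁⟩ := exists_mem_inf_kerSubgroup_smul_ne κ D hD hcont Φ hΦ hτD hτΦ hmove
  obtain ⟨-, hgen⟩ := exists_zsmul_eq_of_natCard_eq Φ hΦ hP hne
  obtain ⟨k, rfl⟩ := hgen P₁ hP₁
  exact hgP₁ (by rw [smul_comm g k P, hfix g hg])

/-! ## §2. The fixed part of a finite stable subgroup containing the line -/

omit [NumberField K] [TopologicalSpace M] [DiscreteTopology M] in
/-- `D ⊓ ker κ`-fixed points are permuted by `D` (`ker κ` is normal, `D` a subgroup). [folklore] -/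
theorem smul_fixed_of_mem (D : Subgroup (absoluteGaloisGroup K)) {d : absoluteGaloisGroup K} (hd : d ∈ D)
    {m : M} (hm : ∀ g ∈ D ⊓ κ.kerSubgroup, g • m = m) : ∀ g ∈ D ⊓ κ.kerSubgroup, g • d • m = d • m := by
  intro g hg
  obtain ⟨hgD, hgk⟩ := Subgroup.mem_inf.mp hg
  have hconj : d⁻¹ * g * d ∈ D ⊓ κ.kerSubgroup := by
    refine Subgroup.mem_inf.mpr ⟨D.mul_mem (D.mul_mem (D.inv_mem hd) hgD) hd, ?_⟩
    rw [ZpExtension.mem_kerSubgroup] at hgk ⊢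
    rw [map_mul, map_mul, map_inv, hgk, mul_one, inv_mul_cancel]
  calc g • d • m = d • ((d⁻¹ * g * d) • m) := by rw [mul_smul, mul_smul, smul_inv_smul]
    _ = d • m := by rw [hm _ hconj]

/-- **`#T^{D ⊓ ker κ} · p ≤ #T`** for a finite subgroup `T ⊇ Φ` and any subgroup `F ≤ T` of `D ⊓ ker κ`-fixed points,
when some `τ ∈ D` with `τ Φ ⊆ Φ` moves the line `Φ`: `F ∩ Φ = 0` (`eq_zero_of_mem_line_of_fixed`), so `F` embeds in
`T/Φ`. [cite: KellerYin2024, §1.3 Lemma 1.3.5 (arXiv:2402.12781v2 TeX L1009–1013)] -/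
theorem natCard_mul_le_of_fixed (D : Subgroup (absoluteGaloisGroup K))
    (hD : IsClosed (D : Set (absoluteGaloisGroup K)))
    (hcont : ∀ m : M, Continuous fun g : absoluteGaloisGroup K ↦ g • m)
    (Φ T F : AddSubgroup M) [Finite T] (hΦT : Φ ≤ T) (hFT : F ≤ T) (hΦ : Nat.card Φ = p)
    {τ : absoluteGaloisGroup K} (hτD : τ ∈ D) (hτΦ : ∀ P ∈ Φ, τ • P ∈ Φ) (hmove : ∃ P ∈ Φ, τ • P ≠ P)
    (hF : ∀ m ∈ F, ∀ g ∈ D ⊓ κ.kerSubgroup, g • m = m) : Nat.card F * p ≤ Nat.card T := by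
  set ΦT : AddSubgroup T := Φ.addSubgroupOf T with hΦT'
  have hcardΦT : Nat.card ΦT = p := by
    rw [hΦT', Nat.card_congr (AddSubgroup.addSubgroupOfEquivOfLe hΦT).toEquiv, hΦ]
  -- `F → T ⧸ Φ` is injective
  let f : F → T ⧸ ΦT := fun m ↦ QuotientAddGroup.mk ⟨(m : M), hFT m.2⟩
  have hf : Function.Injective f := by
    intro a b hab
    have h := (QuotientAddGroup.eq.mp hab)
    rw [hΦT', AddSubgroup.mem_addSubgroupOf] at h
    have hmem : -(a : M) + b ∈ Φ := by simpa using h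
    have hfix : ∀ g ∈ D ⊓ κ.kerSubgroup, g • (-(a : M) + b) = -(a : M) + b := fun g hg ↦ by
      rw [smul_add, smul_neg, hF _ a.2 g hg, hF _ b.2 g hg]
    have h0 := eq_zero_of_mem_line_of_fixed κ D hD hcont Φ hΦ hτD hτΦ hmove hmem hfix
    exact Subtype.ext (neg_add_eq_zero.mp h0)
  have hle : Nat.card F ≤ Nat.card (T ⧸ ΦT) := Nat.card_le_card_of_injective f hf
  calc Nat.card F * p ≤ Nat.card (T ⧸ ΦT) * Nat.card ΦT := by
        rw [hcardΦT]; exact Nat.mul_le_mul_right _ hle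
    _ = Nat.card T := (AddSubgroup.card_eq_card_quotient_mul_card_addSubgroup ΦT).symm

/-- **`T^{D ⊓ ker κ} = T^D` when `#T = p²`** (`T = E[p]`): a point of the finite `D`-stable subgroup `T ⊇ Φ` fixed by
the local tower group is fixed by all of `D`, provided some `τ ∈ D` with `τ Φ ⊆ Φ` moves the line `Φ`. Indeed the
fixed subgroup `F` has `#F · p ≤ p²` and `#F ∣ p²`, so `F = 0` or `F` is a `D`-stable line fixed pointwise by
`D ⊓ ker κ`, to which `smul_eq_of_fixed_inf_kerSubgroup` applies. At the good anomalous datum: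
`E(K_{∞,v̄})[p] = E(K_v̄)[p]` (KY's Cases I/II vs III are read off `E(ℚ_p)[p]`).
[cite: KellerYin2024, §1.4 Cases I–III (arXiv:2402.12781v2 TeX L1142–1147)] [cite: GreenbergLNM1716, §4 proof of Prop. 4.8 (p. 109)] -/
theorem smul_eq_of_fixed_of_natCard_eq_sq (D : Subgroup (absoluteGaloisGroup K))
    (hD : IsClosed (D : Set (absoluteGaloisGroup K)))
    (hcont : ∀ m : M, Continuous fun g : absoluteGaloisGroup K ↦ g • m)
    (Φ T : AddSubgroup M) (hΦT : Φ ≤ T) (hΦ : Nat.card Φ = p) (hT : Nat.card T = p ^ 2)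
    (hTD : ∀ d ∈ D, ∀ m ∈ T, d • m ∈ T)
    {τ : absoluteGaloisGroup K} (hτD : τ ∈ D) (hτΦ : ∀ P ∈ Φ, τ • P ∈ Φ) (hmove : ∃ P ∈ Φ, τ • P ≠ P)
    {m : M} (hmT : m ∈ T) (hm : ∀ g ∈ D ⊓ κ.kerSubgroup, g • m = m) : ∀ d ∈ D, d • m = m := by
  have hpr : p.Prime := hp.out
  haveI : Finite T := Nat.finite_of_card_ne_zero (by rw [hT]; exact pow_ne_zero _ hpr.ne_zero)
  -- the fixed subgroup `F ≤ T`
  let F : AddSubgroup M :=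
    { carrier := {x | x ∈ T ∧ ∀ g ∈ D ⊓ κ.kerSubgroup, g • x = x}
      add_mem' := fun {a b} ha hb ↦ ⟨T.add_mem ha.1 hb.1, fun g hg ↦ by rw [smul_add, ha.2 g hg, hb.2 g hg]⟩
      zero_mem' := ⟨T.zero_mem, fun g _ ↦ smul_zero g⟩
      neg_mem' := fun {a} ha ↦ ⟨T.neg_mem ha.1, fun g hg ↦ by rw [smul_neg, ha.2 g hg]⟩ }
  have hmemF : ∀ x, x ∈ F ↔ x ∈ T ∧ ∀ g ∈ D ⊓ κ.kerSubgroup, g • x = x := fun _ ↦ Iff.rfl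
  have hFT : F ≤ T := fun x hx ↦ ((hmemF x).mp hx).1
  have hmF : m ∈ F := (hmemF m).mpr ⟨hmT, hm⟩
  have hFD : ∀ d ∈ D, ∀ x ∈ F, d • x ∈ F := fun d hd x hx ↦
    (hmemF _).mpr ⟨hTD d hd x ((hmemF x).mp hx).1, smul_fixed_of_mem κ D hd ((hmemF x).mp hx).2⟩
  -- `#F ≤ p` and `#F ∣ p²`
  have hle : Nat.card F * p ≤ p ^ 2 := hT ▸ natCard_mul_le_of_fixed κ D hD hcont Φ T F hΦT hFT hΦ hτD hτΦ
    hmove (fun x hx ↦ ((hmemF x).mp hx).2)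
  have hdvd : Nat.card F ∣ p ^ 2 := hT ▸ AddSubgroup.card_dvd_of_le hFT
  obtain ⟨i, hi, hFi⟩ := (Nat.dvd_prime_pow hpr).mp hdvd
  have hi1 : i ≤ 1 := by
    by_contra hi2
    have h2 : i = 2 := by omega
    rw [hFi, h2, ← pow_succ] at hle
    exact absurd hle (not_le.mpr (Nat.pow_lt_pow_right hpr.one_lt (by norm_num)))
  intro d hd
  rcases Nat.le_one_iff_eq_zero_or_eq_one.mp hi1 with h0 | h1
  · -- `F = 0`
    rw [h0, pow_zero] at hFi
    haveI : Finite F := Nat.finite_of_card_ne_zero (by rw [hFi]; exact one_ne_zero)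
    have hbot : F = ⊥ := AddSubgroup.eq_bot_of_card_eq F hFi
    have hm0 : m = 0 := by
      have : m ∈ (⊥ : AddSubgroup M) := hbot ▸ hmF
      exact (AddSubgroup.mem_bot).mp this
    rw [hm0, smul_zero]
  · -- `F` is a `D`-stable line fixed pointwise by `D ⊓ ker κ`
    rw [h1, pow_one] at hFi
    exact smul_eq_of_fixed_inf_kerSubgroup κ D hD hcont F hFi hd (hFD d hd)
      (fun g hg x hx ↦ ((hmemF x).mp hx).2 g hg) m hmF

end Line

/-! ## §3. Cocyclicity: a `p`-primary subgroup with `#B[p] ≤ p` is finite or `p`-divisible -/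

section Cocyclic

variable {M : Type} [AddCommGroup M]

/-- **Finite or divisible.** In a `p`-primary abelian group with finite layers `M[p^k]`, a subgroup `B` with at most
`p` elements killed by `p` is either FINITE or `p`-DIVISIBLE (`B = pB`): apply the tree's dichotomy
`le_or_finite_of_card_layer_le` to `pB ≤ B` — if `pB` is finite so is `B` (an extension of `pB` by `B[p]`).
(`B = E[p^∞]^{D_v̄ ⊓ ker κ}` at an anomalous `v̄`: `≅ 𝒪/𝔭^b` or `F/𝒪`, KY Prop. 1.3.3 (iii).)
[cite: KellerYin2024, §1.3 Prop. 1.3.3 (ii)–(iii) (arXiv:2402.12781v2 TeX L922–931)] -/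
theorem finite_or_forall_exists_nsmul_eq (htor : ∀ m : M, ∃ k : ℕ, p ^ k • m = 0)
    (hfin : ∀ k : ℕ, Set.Finite {m : M | p ^ k • m = 0}) (B : AddSubgroup M)
    (hB1 : Set.ncard {c : M | c ∈ B ∧ p • c = 0} ≤ p) :
    (B : Set M).Finite ∨ ∀ x ∈ B, ∃ y ∈ B, p • y = x := by
  set φ : B →+ M := (DistribSMul.toAddMonoidHom M p).comp B.subtype with hφ
  have hφ_apply : ∀ y : B, φ y = p • (y : M) := fun _ ↦ rfl
  set pB : AddSubgroup M := φ.range with hpB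
  have hpBle : pB ≤ B := by
    rintro x ⟨y, rfl⟩
    rw [hφ_apply]; exact B.nsmul_mem y.2 p
  rcases le_or_finite_of_card_layer_le (p := p) B pB hpBle htor hfin hB1 with h | h
  · right
    intro x hx
    obtain ⟨y, hy⟩ := h hx
    exact ⟨y, y.2, by rw [← hφ_apply, hy]⟩
  · left
    haveI : Finite pB := h.to_subtype
    haveI : Finite φ.range := by rw [← hpB]; infer_instance
    -- `ker φ ⊆ B[p]` is finite
    have hker : Finite φ.ker := by
      have h1 : {m : M | p ^ 1 • m = 0}.Finite := hfin 1
      haveI : Finite {m : M | p ^ 1 • m = 0} := h1.to_subtype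
      refine Finite.of_injective (fun y : φ.ker ↦ (⟨((y : B) : M), ?_⟩ : {m : M | p ^ 1 • m = 0})) ?_
      · have hy := (AddMonoidHom.mem_ker).mp y.2
        rw [hφ_apply] at hy
        change p ^ 1 • ((y : B) : M) = 0
        rwa [pow_one]
      · intro a b hab
        apply Subtype.ext; apply Subtype.ext
        exact congrArg (fun z : {m : M | p ^ 1 • m = 0} ↦ (z : M)) hab
    haveI := hker
    haveI : Finite (B ⧸ φ.ker) := Finite.of_equiv _ (QuotientAddGroup.quotientKerEquivRange φ).toEquiv.symm
    haveI : Finite B := Finite.of_equiv _ (AddSubgroup.addGroupEquivQuotientProdAddSubgroup (s := φ.ker)).symm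
    exact Set.toFinite _

/-- **`#(B/pB) ≤ p`** for such a `B` (as `Nat.card` of the quotient of `B` by the range of `p·`): in the finite case
`#(B/pB) = #B[p] ≤ p` (UTD's `natCard_quotient_eq_natCard_pTorsion_of_finite`), in the divisible case `B/pB = 0`.
[cite: KellerYin2024, §1.3 Lemma 1.3.5 (arXiv:2402.12781v2 TeX L1009–1013)] -/
theorem natCard_quotient_nsmul_le (htor : ∀ m : M, ∃ k : ℕ, p ^ k • m = 0)
    (hfin : ∀ k : ℕ, Set.Finite {m : M | p ^ k • m = 0}) (B : AddSubgroup M)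
    (hB1 : Set.ncard {c : M | c ∈ B ∧ p • c = 0} ≤ p) :
    Nat.card (B ⧸ (DistribSMul.toAddMonoidHom B p).range) ≤ p := by
  have hpr : p.Prime := hp.out
  rcases finite_or_forall_exists_nsmul_eq htor hfin B hB1 with h | h
  · haveI : Finite B := h.to_subtype
    rw [UniversalToricDescentLocalKummer.natCard_quotient_eq_natCard_pTorsion_of_finite]
    -- `ker (p·) ↪ {c ∈ B | p c = 0}`
    have h1 : (({c : M | c ∈ B ∧ p • c = 0}) : Set M).Finite := (hfin 1).subset fun c hc ↦ by
      change p ^ 1 • c = 0; rw [pow_one]; exact hc.2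
    rw [← Nat.card_coe_set_eq] at hB1
    haveI : Finite {c : M | c ∈ B ∧ p • c = 0} := h1.to_subtype
    refine le_trans (Nat.card_le_card_of_injective (fun y : (DistribSMul.toAddMonoidHom B p).ker ↦
      (⟨((y : B) : M), (y : B).2, ?_⟩ : {c : M | c ∈ B ∧ p • c = 0})) ?_) hB1
    · have hy := (AddMonoidHom.mem_ker).mp y.2
      have hy' : p • (y : B) = 0 := hy
      rw [← AddSubgroupClass.coe_nsmul, hy', ZeroMemClass.coe_zero]
    · intro a b hab
      apply Subtype.ext; apply Subtype.ext
      exact congrArg (fun z : {c : M | c ∈ B ∧ p • c = 0} ↦ (z : M)) hab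
  · -- divisible: the quotient is trivial
    have htop : (DistribSMul.toAddMonoidHom B p).range = ⊤ := by
      rw [eq_top_iff]
      rintro x -
      obtain ⟨y, hyB, hy⟩ := h x x.2
      exact ⟨⟨y, hyB⟩, Subtype.ext (by rw [← hy]; rfl)⟩
    haveI : Subsingleton (B ⧸ (DistribSMul.toAddMonoidHom B p).range) := by
      rw [htop]; exact QuotientAddGroup.subsingleton_quotient_top
    calc Nat.card (B ⧸ (DistribSMul.toAddMonoidHom B p).range) ≤ 1 := Finite.card_le_one_iff_subsingleton.mpr ‹_›
      _ ≤ p := hpr.one_lt.le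

end Cocyclic

end Summit.BirchSwinnertonDyer.BirchSwinnertonDyer.Theorems.AnomalousLocalTorsion
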